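import Summits.CriticalPhenomena.PercolationContinuityZ3.Theorems.PercNearOneGluingNoHeavyLowerTailFKCSHWorldCov
import Summits.CriticalPhenomena.PercolationContinuityZ3.Theorems.PercNearOneGluingNoHeavyLowerTailFKCSHPhiDefs
import Summits.CriticalPhenomena.PercolationContinuityZ3.Theorems.PercNearOneGluingNoHeavyLowerTailCSHUnfoldDecoy
import HarnessLib

/-!
# FK sub-lane: Lemma U_FK, file 2 — the WORLD TERM OF ONE DECOY for `φ_{w,q}`
# (rc Markov at `C_Y`, dead decoys drop out, rc Markov at `C_d`, Lemma Φ(a) = definition of `Φ_FK`, centring at the decoy constant)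

Support / definitions file (`--supports stmt-CriticalPhenomena-4575`), FK sub-lane `prim-bschramm-fk-1` (gen 2) of the post-continuity
programme; builds on p205010 (kernel theorem, internal audit signed; external expert review pending).  No named facts, no sorries; standard
axioms.  Second file of the port plan bschramm/FK-DEFS.md §6.3: prim-ineq-prove-1's `…NoHeavyLowerTailCSHUnfoldDecoy.lean` for the random-cluster
measure, with `weight ŵ ↦ rcMass w q`, world means `FK.wE w q (cut Y ζ)` (van den Berg–Häggström–Kahn's Lemma 2.3 for `φ_{𝐩,q}`), the
residual functional `FK.phiFK` (fk-1, `…FKCSHPhiDefs.lean`) in place of `CSH.phiFun`.  The measure-free pieces (`CSH.world_term_alive/dead`,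
`CSH.chi/av/jn`, `CSH.slForm`) are reused from the `q = 1` files.

* `FK.rc_set_sum_cond` — conditioning on the cluster of a set, kernel form (`HullPort.set_sum_cond_sdiff` for `φ_{w,q}`);
* `FK.residFK` — the telescoping residual `Θ(ζ) = 1{x↮Y}(g(C_x ζ) − ḡ(ζ))` with the FK world mean; `FK.phiFK_eq_neg_sum_residFK`,
  `FK.sum_residFK_world_singleton` (Lemma Φ(a) for FK is the DEFINITION of `Φ_FK`: `Σ_η m^{cut_d ζ}(η) Θ(η) = −Φ_FK(C_d ζ)`);
* `FK.sum_residFK_mul_clusterFn`, `FK.sum_residFK_decoy_moment` — rc Markov at the cluster of the decoy, centring;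
* `FK.decoy_world_term_rc` — **the world term of one decoy**:
  `Σ_ω m 1{x↮Y} Cov_{φ^ω}(g(C_x), ε(d)·sl_{L'}[χ_d − c](u)) = −m₀⁻¹ · sl_{L'}[w' ↦ m₀·P₁(w') − m₁(w')·P₀](u)` with the `Φ_FK`-moments `P₁, P₀`.
[cite: VandenbergHaggstromKahn2005, §2.1 Lemmas 2.3–2.4 (p. 10); §1 display (10) (pp. 7–8) — corollaries] [cite: Grimmett2006, §1.4 eq. (1.20) (p. 15)]
-/

noncomputable section

namespace Summit.CriticalPhenomena.PercolationContinuityZ3.Theorems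

open MeasureTheory Set Literature.Probability.LatticeModels Literature.Probability.Percolation
open scoped Classical
open BHK2006 DecisionTree HullPort

namespace FK

variable {V : Type*} [Fintype V]

/-! ### Conditioning on the cluster of a set, kernel form -/

/-- **Conditioning on the cluster of a set, kernel form, for `φ_{w,q}`** (`HullPort.set_sum_cond_sdiff` for the random-cluster
measure): `Σ_ω m(ω) K(C_S(ω), ω ∖ S̄(C_S ω)) = Σ_ω m(ω) Σ_η m^{S̄(C_S ω)}(η) K(C_S(ω), η)` — given the cluster of `S`, the configuration
off the pairs meeting it is `φ_{G − S̄, q}` (van den Berg–Häggström–Kahn's Lemma 2.3/2.4 for `φ_{𝐩,q}`, `BHK2006.rcMass_sum_setCl_eq`).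
[cite: VandenbergHaggstromKahn2005, §2.1 Lemmas 2.3–2.4 (p. 10)] -/
theorem rc_set_sum_cond (w : Sym2 V → unitInterval) {q : ℝ} (hq : 0 < q) (S : Set V)
    (K : Set (Sym2 V) → Set (Sym2 V) → ℝ) :
    ∑ ω, rcMass w q ω * K (setCl ω S) (ω \ barOf S (setCl ω S)) =
      ∑ ω, rcMass w q ω * ∑ η, rcMass (delW w (barOf S (setCl ω S))) q η * K (setCl ω S) η := by
  classical
  have hL : ∀ ω, rcMass w q ω * K (setCl ω S) (ω \ barOf S (setCl ω S)) =
      ∑ W : Set (Sym2 V), (if setCl ω S = W then rcMass w q ω * K W (ω \ barOf S W) else 0) := fun ω => by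
    rw [Fintype.sum_ite_eq (setCl ω S) (fun W => rcMass w q ω * K W (ω \ barOf S W))]
  have hR : ∀ ω, rcMass w q ω * ∑ η, rcMass (delW w (barOf S (setCl ω S))) q η * K (setCl ω S) η =
      ∑ W : Set (Sym2 V), (if setCl ω S = W then rcMass w q ω * ∑ η, rcMass (delW w (barOf S W)) q η * K W η else 0) :=
    fun ω => by
    rw [Fintype.sum_ite_eq (setCl ω S) (fun W => rcMass w q ω * ∑ η, rcMass (delW w (barOf S W)) q η * K W η)]
  rw [Finset.sum_congr rfl fun ω _ => hL ω, Finset.sum_congr rfl fun ω _ => hR ω, Finset.sum_comm]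
  conv_rhs => rw [Finset.sum_comm]
  refine Finset.sum_congr rfl fun W _ => ?_
  rw [rcMass_sum_setCl_eq w hq S W (K W)]
  rw [Finset.sum_mul]
  refine Finset.sum_congr rfl fun ω _ => ?_
  split_ifs <;> simp

/-! ### The residual `Θ` for `φ_{w,q}` and the functional `Φ_FK` at the cluster of a decoy -/

/-- **The telescoping residual for `φ_{w,q}`**: `Θ(ζ) = 1{x ↮ Y}(ζ)·(g(C_x(ζ)) − ḡ(ζ))`, `ḡ(ζ) = E_{φ_{G − cut_Y(ζ), q}}[g(C_x)]` the
world mean of Lemma T_rc. (transcription of the cell memo prim-hp-8 PROOF-S5-ALL-R.md §3.1, FK worlds) [cite: VandenbergHaggstromKahn2005, §2.1 Lemma 2.3 (p. 10)] -/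
def residFK (w : Sym2 V → unitInterval) (q : ℝ) (x : V) (Y : Set V) (g : Set (Sym2 V) → ℝ) (ζ : Set (Sym2 V)) : ℝ :=
  ind (avoidEv x Y) ζ * (g (openEdgeCluster ζ x) - wE w q (cut Y ζ) (fun β => g (openEdgeCluster β x)))

/-- The world mean of Lemma T_rc is `FK.wE` over the cut (sum form of `FK.worldMeanY`). [cite: VandenbergHaggstromKahn2005, §2.1 Lemma 2.3 (p. 10)] -/
theorem worldMeanY_eq_wE (w : Sym2 V → unitInterval) {q : ℝ} (hq : 0 < q) (x : V) (Y : Set V) (g : Set (Sym2 V) → ℝ)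
    (ζ : Set (Sym2 V)) : worldMeanY w q x Y g ζ = wE w q (cut Y ζ) (fun β => g (openEdgeCluster β x)) := by
  unfold worldMeanY wE
  exact integral_rcMeasureW_eq_sum (delW w (cut Y ζ)) hq _

/-- **`Φ_FK` at sum level**: `Φ_FK(K) = −Σ_η m^{edgesOf K}(η) Θ(η)`. [cite: VandenbergHaggstromKahn2005, §2.1 Lemma 2.3 (p. 10)] -/
theorem phiFK_eq_neg_sum_residFK (w : Sym2 V → unitInterval) {q : ℝ} (hq : 0 < q) (x : V) (Y : Set V)
    (g : Set (Sym2 V) → ℝ) (K : Set V) :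
    phiFK w q x Y g K = - ∑ η, rcMass (delW w (CSH.edgesOf K)) q η * residFK w q x Y g η := by
  unfold phiFK
  have hD : {ω : BondConfig V | ∀ y ∈ Y, ¬ (openGraph ω).Reachable x y} = avoidEv x Y := rfl
  rw [hD, setIntegral_rcMeasureW_eq_sum (delW w (CSH.edgesOf K)) hq, ← Finset.sum_neg_distrib]
  refine Finset.sum_congr rfl fun η _ => ?_
  rw [worldMeanY_eq_wE w hq]
  unfold residFK
  ring

/-- Deleting the cut set of a decoy avoiding `{x} ∪ Y` does not change the residual `Θ` (the cut of `Y` and the cluster of `x` are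
untouched). [folklore] -/
theorem residFK_sdiff_cut_singleton (w : Sym2 V → unitInterval) (q : ℝ) {x : V} {Y : Set V} (g : Set (Sym2 V) → ℝ) {d : V}
    {ζ : Set (Sym2 V)} (h : ζ ∈ avoidEv d (insert x Y)) : residFK w q x Y g (ζ \ cut {d} ζ) = residFK w q x Y g ζ := by
  have hdY : ζ ∈ avoidEv d Y := fun y hy => h y (mem_insert_of_mem x hy)
  have hxd : ζ ∈ avoidEv x {d} := fun t ht => by
    rw [mem_singleton_iff] at ht; subst ht
    exact fun hr => h x (mem_insert x Y) hr.symm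
  unfold residFK
  have e1 : openEdgeCluster (ζ \ cut {d} ζ) x = openEdgeCluster ζ x := CSH.openEdgeCluster_sdiff_cut_of_avoid hxd
  have e2 : cut Y (ζ \ cut {d} ζ) = cut Y ζ := CSH.cut_sdiff_cut_singleton_of_avoid hdY
  have e3 : ind (avoidEv x Y) (ζ \ cut {d} ζ) = ind (avoidEv x Y) ζ := by
    by_cases hx : ζ ∈ avoidEv x Y
    · rw [ind_of_mem hx, ind_of_mem]
      exact fun y hy hr => hx y hy ((CSH.reachable_sdiff_cut_iff_of_avoid hxd y).1 hr)
    · rw [ind_of_not_mem hx, ind_of_not_mem]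
      exact fun h' => hx fun y hy hr => h' y hy ((CSH.reachable_sdiff_cut_iff_of_avoid hxd y).2 hr)
  rw [e1, e2, e3]

/-- **Lemma Φ(a) for `φ_{w,q}` is the definition of `Φ_FK`**: the world mean of `Θ` off the cluster of `d` is `−Φ_FK(C_d)`:
`Σ_η m^{cut_d ζ}(η) Θ(η) = −Φ_FK(C_d(ζ))` (no product structure needed). [cite: VandenbergHaggstromKahn2005, §2.1 Lemma 2.3 (p. 10)] -/
theorem sum_residFK_world_singleton (w : Sym2 V → unitInterval) {q : ℝ} (hq : 0 < q) (x : V) (Y : Set V)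
    (g : Set (Sym2 V) → ℝ) (d : V) (ζ : Set (Sym2 V)) :
    ∑ η, rcMass (delW w (cut {d} ζ)) q η * residFK w q x Y g η = - phiFK w q x Y g (openCluster ζ d) := by
  rw [phiFK_eq_neg_sum_residFK w hq, neg_neg, ← CSH.cut_singleton_eq_edgesOf]

/-- **Markov at the cluster of a decoy + Lemma Φ(a), for `φ_{w,q}`**: for every function `f` of the open edge cluster of `d` and every
avoided set `A ⊇ {x} ∪ Y`:  `Σ_ζ m Θ(ζ)·1{d ↮ A}(ζ)·f(C_d(ζ)) = −Σ_ζ m 1{d ↮ A}(ζ)·f(C_d(ζ))·Φ_FK(C_d(ζ))`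
(`CSH.sum_resid_mul_clusterFn` for the random-cluster measure: rc Lemma 2.3 at the cluster of `d`, `FK.rc_set_sum_cond`).
[cite: VandenbergHaggstromKahn2005, §2.1 Lemmas 2.3–2.4 (p. 10) — corollary] -/
theorem sum_residFK_mul_clusterFn (w : Sym2 V → unitInterval) {q : ℝ} (hq : 0 < q) (x : V) (Y : Set V)
    (g : Set (Sym2 V) → ℝ) (d : V) {A : Set V} (hA : insert x Y ⊆ A) (f : Set (Sym2 V) → ℝ) :
    ∑ ζ, rcMass w q ζ * (residFK w q x Y g ζ * (ind (avoidEv d A) ζ * f (openEdgeCluster ζ d))) =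
      - ∑ ζ, rcMass w q ζ * (ind (avoidEv d A) ζ * f (openEdgeCluster ζ d) * phiFK w q x Y g (openCluster ζ d)) := by
  classical
  set K : Set (Sym2 V) → Set (Sym2 V) → ℝ := fun W β =>
    (if (∀ a ∈ A, ¬ (a ∈ ({d} : Set V) ∨ ∃ e ∈ W, a ∈ e)) then 1 else 0) * f W * residFK w q x Y g β with hK
  have key := rc_set_sum_cond w hq {d} K
  have hL : ∀ ζ, rcMass w q ζ * K (setCl ζ {d}) (ζ \ barOf {d} (setCl ζ {d})) =
      rcMass w q ζ * (residFK w q x Y g ζ * (ind (avoidEv d A) ζ * f (openEdgeCluster ζ d))) := by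
    intro ζ
    simp only [hK]
    rw [← CSH.ind_avoidEv_eq_ite_cluster d A ζ, ← cut_eq_barOf, setCl_singleton]
    by_cases h : ζ ∈ avoidEv d A
    · rw [residFK_sdiff_cut_singleton w q g (fun a ha => h a (hA ha))]; ring
    · rw [ind_of_not_mem h]; ring
  have hR : ∀ ζ, rcMass w q ζ * ∑ η, rcMass (delW w (barOf {d} (setCl ζ {d}))) q η * K (setCl ζ {d}) η =
      - (rcMass w q ζ * (ind (avoidEv d A) ζ * f (openEdgeCluster ζ d) * phiFK w q x Y g (openCluster ζ d))) := by
    intro ζ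
    simp only [hK]
    rw [← CSH.ind_avoidEv_eq_ite_cluster d A ζ, ← cut_eq_barOf, setCl_singleton]
    have e : ∑ η, rcMass (delW w (cut {d} ζ)) q η * (ind (avoidEv d A) ζ * f (openEdgeCluster ζ d) * residFK w q x Y g η) =
        ind (avoidEv d A) ζ * f (openEdgeCluster ζ d) * ∑ η, rcMass (delW w (cut {d} ζ)) q η * residFK w q x Y g η := by
      rw [Finset.mul_sum]; exact Finset.sum_congr rfl fun η _ => by ring
    rw [e, sum_residFK_world_singleton w hq x Y g d ζ]; ring
  calc _ = ∑ ζ, rcMass w q ζ * K (setCl ζ {d}) (ζ \ barOf {d} (setCl ζ {d})) :=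
        Finset.sum_congr rfl fun ζ _ => (hL ζ).symm
    _ = ∑ ζ, rcMass w q ζ * ∑ η, rcMass (delW w (barOf {d} (setCl ζ {d}))) q η * K (setCl ζ {d}) η := key
    _ = ∑ ζ, - (rcMass w q ζ * (ind (avoidEv d A) ζ * f (openEdgeCluster ζ d) * phiFK w q x Y g (openCluster ζ d))) :=
        Finset.sum_congr rfl fun ζ _ => hR ζ
    _ = _ := by rw [Finset.sum_neg_distrib]

/-! ### Centring at the decoy constant -/

/-- **The centred decoy moment for `φ_{w,q}`** (memo §3.3: `E_{ρ_j}[Θ·(1{w∈C_{d_j}} − c_j(w))] = −Cov_{ρ_j}(Φ(C_{d_j}), 1{w∈C_{d_j}})`,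
denominator-free): with `E = {d ↮ A}` (`A ⊇ {x} ∪ Y`), `m₀ = φ(E) ≠ 0`, `m₁ = φ(E ∩ {d↔w'})`, `c = m₁/m₀`,
`P₁ = Σ m 1_E 1{d↔w'} Φ_FK(C_d)`, `P₀ = Σ m 1_E Φ_FK(C_d)`:  `Σ_ζ m Θ·1_E·(1{d↔w'} − c) = −m₀⁻¹·(m₀ P₁ − m₁ P₀)`.
(`CSH.sum_resid_decoy_moment` for the random-cluster measure) [cite: VandenbergHaggstromKahn2005, §2.1 Lemma 2.4 (p. 10) — corollary] -/
theorem sum_residFK_decoy_moment (w : Sym2 V → unitInterval) {q : ℝ} (hq : 0 < q) (x : V) (Y : Set V)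
    (g : Set (Sym2 V) → ℝ) (d : V) {A : Set V} (hA : insert x Y ⊆ A) (w' : V) {c : ℝ}
    (hm₀ : ∑ ζ, rcMass w q ζ * ind (avoidEv d A) ζ ≠ 0)
    (hc : c = (∑ ζ, rcMass w q ζ * ind (avoidEv d A ∩ openConn d w') ζ) / ∑ ζ, rcMass w q ζ * ind (avoidEv d A) ζ) :
    ∑ ζ, rcMass w q ζ * (residFK w q x Y g ζ * (ind (avoidEv d A) ζ * (ind (openConn d w' : Set (BondConfig V)) ζ - c))) =
      - ((∑ ζ, rcMass w q ζ * ind (avoidEv d A) ζ)⁻¹ *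
          ((∑ ζ, rcMass w q ζ * ind (avoidEv d A) ζ) *
              (∑ ζ, rcMass w q ζ * (ind (avoidEv d A ∩ openConn d w') ζ * phiFK w q x Y g (openCluster ζ d))) -
            (∑ ζ, rcMass w q ζ * ind (avoidEv d A ∩ openConn d w') ζ) *
              (∑ ζ, rcMass w q ζ * (ind (avoidEv d A) ζ * phiFK w q x Y g (openCluster ζ d))))) := by
  set f : Set (Sym2 V) → ℝ := fun K => (if (w' = d ∨ ∃ e ∈ K, w' ∈ e) then (1 : ℝ) else 0) - c with hf
  have hfK : ∀ ζ : Set (Sym2 V), f (openEdgeCluster ζ d) = ind (openConn d w' : Set (BondConfig V)) ζ - c := by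
    intro ζ; rw [hf, CSH.ind_openConn_eq_ite_cluster]
  have h1 := sum_residFK_mul_clusterFn w hq x Y g d hA f
  simp only [hfK] at h1
  rw [h1]
  set m₀ := ∑ ζ, rcMass w q ζ * ind (avoidEv d A) ζ with hm₀'
  set m₁ := ∑ ζ, rcMass w q ζ * ind (avoidEv d A ∩ openConn d w') ζ with hm₁'
  set P₁ := ∑ ζ, rcMass w q ζ * (ind (avoidEv d A ∩ openConn d w') ζ * phiFK w q x Y g (openCluster ζ d)) with hP₁
  set P₀ := ∑ ζ, rcMass w q ζ * (ind (avoidEv d A) ζ * phiFK w q x Y g (openCluster ζ d)) with hP₀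
  have e : ∑ ζ, rcMass w q ζ * (ind (avoidEv d A) ζ * (ind (openConn d w' : Set (BondConfig V)) ζ - c) *
      phiFK w q x Y g (openCluster ζ d)) = P₁ - c * P₀ := by
    rw [hP₁, hP₀, Finset.mul_sum, ← Finset.sum_sub_distrib]
    refine Finset.sum_congr rfl fun ζ _ => ?_
    rw [ind_inter]; ring
  rw [e, hc]
  field_simp

/-! ### The world term of one decoy -/

/-- **THE WORLD TERM OF ONE DECOY, for `φ_{w,q}`** (memo §3.3, the `j`-th term of Lemma U, before the `o − p·v` combination; `CSH.decoy_world_term`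
for the random-cluster measure).  Data: owner `x`, avoided set `Y`, source set `S ∋ x`, decoy `d ∉ S`, later decoys `L'` (none equal to `d`),
marker `u ≠ d`, `E = {d ↮ S ∪ Y}`, `m₀ = φ(E) ≠ 0`, `c(w') = φ(E ∩ {d↔w'})/m₀`.  Then
`Σ_ω m 1{x↮Y} Cov_{φ^ω}(g(C_x), ε(d)·sl_{L'}[χ_d − c](u)) = −m₀⁻¹ · sl_{L'}[w' ↦ m₀·P₁(w') − m₁(w')·P₀](u)`
with `P₁(w') = Σ m 1_E 1{d↔w'} Φ_FK(C_d)`, `P₀ = Σ m 1_E Φ_FK(C_d)` — i.e. `−m₀⁻¹·sl_{L'}[covD_{d, S∪Y}(Φ_FK)](u)` up to normalisation.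
[cite: VandenbergHaggstromKahn2005, §2.1 Lemmas 2.3–2.4 (p. 10) — corollaries] -/
theorem decoy_world_term_rc (w : Sym2 V → unitInterval) {q : ℝ} (hq : 0 < q) (x : V) (Y : Set V) (g : Set (Sym2 V) → ℝ)
    {S : Set V} (hxS : x ∈ S) {d : V} (hdS : d ∉ S) (L' : List (V × (V → ℝ))) (hL' : ∀ dc ∈ L', dc.1 ≠ d)
    {u : V} (hu : u ≠ d) (c : V → ℝ)
    (hm₀ : ∑ ζ, rcMass w q ζ * ind (avoidEv d (S ∪ Y)) ζ ≠ 0)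
    (hc : ∀ w', c w' = (∑ ζ, rcMass w q ζ * ind (avoidEv d (S ∪ Y) ∩ openConn d w') ζ) /
      ∑ ζ, rcMass w q ζ * ind (avoidEv d (S ∪ Y)) ζ) :
    ∑ ω, rcMass w q ω * (ind (avoidEv x Y) ω *
        wcov w q Y (fun β => g (openEdgeCluster β x))
          (fun ζ => CSH.av (openGraph ζ).Reachable S d *
            CSH.slForm L' (fun w' => CSH.chi (openGraph ζ).Reachable w' d - c w') u) ω) =
      - ((∑ ζ, rcMass w q ζ * ind (avoidEv d (S ∪ Y)) ζ)⁻¹ *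
          CSH.slForm L' (fun w' =>
            (∑ ζ, rcMass w q ζ * ind (avoidEv d (S ∪ Y)) ζ) *
                (∑ ζ, rcMass w q ζ * (ind (avoidEv d (S ∪ Y) ∩ openConn d w') ζ * phiFK w q x Y g (openCluster ζ d))) -
              (∑ ζ, rcMass w q ζ * ind (avoidEv d (S ∪ Y) ∩ openConn d w') ζ) *
                (∑ ζ, rcMass w q ζ * (ind (avoidEv d (S ∪ Y)) ζ * phiFK w q x Y g (openCluster ζ d)))) u) := by
  classical
  have hA : insert x Y ⊆ S ∪ Y := by
    intro a ha
    rcases mem_insert_iff.1 ha with rfl | ha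
    · exact Or.inl hxS
    · exact Or.inr ha
  set G : Set (Sym2 V) → ℝ := fun β => g (openEdgeCluster β x) with hG
  set ψ : Set (Sym2 V) → ℝ := fun ζ =>
    CSH.av (openGraph ζ).Reachable S d * CSH.slForm L' (fun w' => CSH.chi (openGraph ζ).Reachable w' d - c w') u with hψ
  set m₀ := ∑ ζ, rcMass w q ζ * ind (avoidEv d (S ∪ Y)) ζ with hm₀'
  set Q : V → ℝ := fun w' =>
    m₀ * (∑ ζ, rcMass w q ζ * (ind (avoidEv d (S ∪ Y) ∩ openConn d w') ζ * phiFK w q x Y g (openCluster ζ d))) -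
      (∑ ζ, rcMass w q ζ * ind (avoidEv d (S ∪ Y) ∩ openConn d w') ζ) *
        (∑ ζ, rcMass w q ζ * (ind (avoidEv d (S ∪ Y)) ζ * phiFK w q x Y g (openCluster ζ d))) with hQ
  -- Step 1: world covariance as a centred world mean, and the Markov merge at `C_Y`
  have step1 : ∑ ω, rcMass w q ω * (ind (avoidEv x Y) ω * wcov w q Y G ψ ω) =
      ∑ ζ, rcMass w q ζ * (residFK w q x Y g ζ * ψ (ζ \ cut Y ζ)) := by
    have h := markov_merge_Y_rc w hq x Y g ψ
    have lhs : ∀ ω, rcMass w q ω * (ind (avoidEv x Y) ω * wcov w q Y G ψ ω) =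
        rcMass w q ω * (ind (avoidEv x Y) ω * ∑ η, rcMass (delW w (cut Y ω)) q η * ((g (openEdgeCluster η x) -
          wE w q (cut Y ω) (fun β => g (openEdgeCluster β x))) * ψ η)) := by
      intro ω; rw [wcov_eq_sum]
    rw [Finset.sum_congr rfl (fun ω _ => lhs ω), h]
    refine Finset.sum_congr rfl fun ζ _ => ?_
    unfold residFK; ring
  -- Step 2: the world test function in the merged configuration (alive / dead decoy)
  have step2 : ∀ ζ, ψ (ζ \ cut Y ζ) =
      ind (avoidEv d (S ∪ Y)) ζ * CSH.slForm L' (fun w' => ind (openConn d w' : Set (BondConfig V)) ζ - c w') u +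
        (1 - ind (avoidEv d Y) ζ) * (- CSH.slForm L' c u) := by
    intro ζ
    by_cases h : ζ ∈ avoidEv d Y
    · rw [hψ]
      dsimp only
      rw [CSH.world_term_alive h S L' c u, ← CSH.ind_avoidEv_mul_union d S Y ζ, ind_of_mem h]; ring
    · rw [hψ]
      dsimp only
      rw [CSH.world_term_dead h hdS L' hL' c hu, ind_of_not_mem h]
      have h0 : ind (avoidEv d (S ∪ Y)) ζ = 0 := ind_of_not_mem fun h' => h fun y hy => h' y (Or.inr hy)
      rw [h0]; ring
  -- Step 3: the dead part dies against the residual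
  have step3 : ∑ ζ, rcMass w q ζ * (residFK w q x Y g ζ * ((1 - ind (avoidEv d Y) ζ) * (- CSH.slForm L' c u))) = 0 := by
    have h := residual_orthogonal_rc w hq x Y g
      (fun W => (1 - (if (d ∈ Y ∨ ∃ e ∈ W, d ∈ e) then (0 : ℝ) else 1)) * (- CSH.slForm L' c u))
    rw [← h]
    refine Finset.sum_congr rfl fun ζ _ => ?_
    unfold residFK
    rw [CSH.one_sub_ind_avoidEv_eq d Y ζ]; ring
  -- Step 4: the alive part, by linearity of `sl_{L'}` and the centred decoy moments
  have step4 : ∑ ζ, rcMass w q ζ * (residFK w q x Y g ζ * (ind (avoidEv d (S ∪ Y)) ζ *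
      CSH.slForm L' (fun w' => ind (openConn d w' : Set (BondConfig V)) ζ - c w') u)) = - (m₀⁻¹ * CSH.slForm L' Q u) := by
    have lin : ∀ ζ, CSH.slForm L' (fun w' => ind (openConn d w' : Set (BondConfig V)) ζ - c w') u =
        ∑ w', CSH.slForm L' (Pi.single w' (1 : ℝ)) u * (ind (openConn d w' : Set (BondConfig V)) ζ - c w') :=
      fun ζ => CSH.slForm_eq_sum_single L' _ u
    simp only [lin, Finset.mul_sum]
    rw [Finset.sum_comm]
    have inner : ∀ w', ∑ ζ, rcMass w q ζ * (residFK w q x Y g ζ * (ind (avoidEv d (S ∪ Y)) ζ *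
        (CSH.slForm L' (Pi.single w' (1 : ℝ)) u * (ind (openConn d w' : Set (BondConfig V)) ζ - c w')))) =
        CSH.slForm L' (Pi.single w' (1 : ℝ)) u * (- (m₀⁻¹ * Q w')) := by
      intro w'
      rw [← sum_residFK_decoy_moment w hq x Y g d hA w' hm₀ (hc w'), Finset.mul_sum]
      exact Finset.sum_congr rfl fun ζ _ => by ring
    rw [Finset.sum_congr rfl (fun w' _ => inner w'), CSH.slForm_eq_sum_single L' Q u, Finset.mul_sum,
      ← Finset.sum_neg_distrib]
    exact Finset.sum_congr rfl fun w' _ => by ring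
  -- assemble
  rw [step1]
  have split : ∀ ζ, rcMass w q ζ * (residFK w q x Y g ζ * ψ (ζ \ cut Y ζ)) =
      rcMass w q ζ * (residFK w q x Y g ζ * (ind (avoidEv d (S ∪ Y)) ζ *
        CSH.slForm L' (fun w' => ind (openConn d w' : Set (BondConfig V)) ζ - c w') u)) +
      rcMass w q ζ * (residFK w q x Y g ζ * ((1 - ind (avoidEv d Y) ζ) * (- CSH.slForm L' c u))) := by
    intro ζ; rw [step2 ζ]; ring
  rw [Finset.sum_congr rfl (fun ζ _ => split ζ), Finset.sum_add_distrib, step3, step4, add_zero]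

end FK

end Summit.CriticalPhenomena.PercolationContinuityZ3.Theorems

end
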